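import Mathlib
import HarnessLib
import Literature.Combinatorics.Additive.StepBeyondKempermanUniqueSums

/-!
# Grynkiewicz 2009, §6 Claim 5, second paragraph: the pairs `(φ_H(aᵢ), φ_H(bᵢ))`, display (41), and the case of one coset

[cite: Grynkiewicz2009, §6 Claim 5 (proof of Thm 4.1, p. 25), display (41)] [tag: critical-pair] [tag: inverse-theorem]

Topic `Literature/Combinatorics/Additive`.  Cell `mm-stpp` (D-0046), seat `mm-stpp-lit` (gen 23); the
port of D. J. Grynkiewicz, *A step beyond Kemperman's structure theorem*, Mathematika **55** (2009)
67–114 continued.  §6 Claim 5, SECOND PARAGRAPH (print p. 25), in the setting of the first one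
(`(A + B) ∪ {γ₁, γ₂} = A + B + H`, file `StepBeyondKempermanTwoHoles.lean`): «Let
`(φ_H(a₁), φ_H(b₁)), …, (φ_H(a_l), φ_H(b_l)) ∈ φ_H(A) × φ_H(B)` be those pairs such that
`φ_H(aᵢ + bᵢ) ∈ {φ_H(γ₁), φ_H(γ₂)}`.  Since `γᵢ ∉ A + B`, it follows in view of Proposition 2.1 that
(41) `|A_{aᵢ}| + |B_{bᵢ}| ≤ |H|` for all `i`.  Suppose `|{φ_H(aᵢ)}| = 1`.  Hence in view of the
non-extendibility of `A`, it follows that `a + H ⊆ A` for all `a ∈ A ∖ A_{a₁}`.  Thus, since `A` is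
non-quasi-periodic (Claim 4), it follows that `A = A_{a₁}`, whence `⟨A⟩ = G` (Claim 4) implies `H = G`.
Hence, since there are exactly `|G| − |B|` elements `α ∈ G` such that `γ₁ ∉ α + B`, and since
`|A| + |B| = |A + B| = |G| − 2`, it follows that there exists such an `α ∈ Ā`.  Likewise, since there are
exactly `|G| − |A| − 1` elements `β ∈ G` such that `γ₁ ∉ β + (A ∪ {α})`, and since `|A| + |B| = |G| − 2`,
it follows that there exists such a `β ∈ B̄`.  Hence `(A ∪ {α}) + (B ∪ {β}) ⊆ G ∖ γ₁`, whence the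
non-extendibility of `(A, B)` implies equality, yielding (17).  So we can assume `|{φ_H(aᵢ)}| ≥ 2`.  By
the same argument, it also follows that `|{φ_H(bᵢ)}| ≥ 2`.»

In the tree's vocabulary a pair `(a, b) ∈ A × B` is RELEVANT when `a + b − γ₁ ∈ H` or `a + b − γ₂ ∈ H`;
«`|{φ_H(aᵢ)}| = 1`» reads «all relevant `a` lie in one coset `a₁ + H`».

MAIN RESULTS (0 definitions, 0 named facts; everything PROVED).
* `Grynkiewicz2009.card_inter_vadd_add_card_inter_vadd_le` — display (41).
* `Grynkiewicz2009.sub_mem_of_forall_add_mem` — a non-quasi-periodic set whose elements off one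
  coset all have their full `H`-coset inside the set lies in that coset («`A = A_{a₁}`»).
* `Grynkiewicz2009.eq_top_of_relevant_subset_coset` — all relevant `a` in one coset ⟹ `H = G`.
* `Grynkiewicz2009.seventeen_of_card_univ_eq` — `|A + B| = |A| + |B| = |G| − 2`, `(A, B)` non-extendible
  (in `A`), `γ ∉ A + B` ⟹ (17) (the counting at the end of the paragraph).
* `Grynkiewicz2009.seventeen_of_relevant_subset_coset` (+ `_right`) — the paragraph's conclusion:
  «`|{φ_H(aᵢ)}| = 1` ⟹ (17)», and the same for the `bᵢ`.

## References
* D. J. Grynkiewicz, *A step beyond Kemperman's structure theorem*, Mathematika 55 (2009) 67–114,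
  doi:10.1112/S0025579300000966, §6 Claim 5 (p. 25), display (41); Prop 2.1 (i)
  [cite: Grynkiewicz2009, Thm 4.1 (proof, Claim 5)] — held `paper:doi-10-1112-s0025579300000966`,
  p0025 read 2026-08-29.
-/

namespace Literature.Combinatorics.Additive

open Finset
open scoped Pointwise

universe u

variable {G : Type u} [AddCommGroup G] [DecidableEq G]

namespace Grynkiewicz2009

/-- **Display (41).**  If `γ ∉ A + B` and `a + b ≡ γ (mod H)`, then `|A_a| + |B_b| ≤ |H|`
(`A_a = A ∩ (a + H)`, `B_b = B ∩ (b + H)`; `H` carried as the finset `Hf`) — otherwise Proposition 2.1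
puts the whole coset `a + b + H ∋ γ` inside `A_a + B_b ⊆ A + B`.
[cite: Grynkiewicz2009, §6 Claim 5, display (41); Prop 2.1 (i)] -/
theorem card_inter_vadd_add_card_inter_vadd_le {A B Hf : Finset G} {H : AddSubgroup G}
    (hHf : ∀ g, g ∈ Hf ↔ g ∈ H) {a b γ : G} (hγ : γ ∉ A + B) (hab : a + b - γ ∈ H) :
    #(A ∩ (a +ᵥ Hf)) + #(B ∩ (b +ᵥ Hf)) ≤ #Hf := by
  by_contra hlt
  have hsub := vadd_subset_add_of_card_lt hHf (inter_subset_right (s₁ := A) (s₂ := a +ᵥ Hf))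
    (inter_subset_right (s₁ := B) (s₂ := b +ᵥ Hf)) (not_le.1 hlt)
  have hγmem : γ ∈ (a + b) +ᵥ Hf := by
    refine mem_vadd_finset.2 ⟨γ - (a + b), (hHf _).2 ?_, by rw [vadd_eq_add]; abel⟩
    have := H.neg_mem hab
    rwa [show -(a + b - γ) = γ - (a + b) by abel] at this
  exact hγ (add_subset_add inter_subset_left inter_subset_left (hsub hγmem))

/-- **«`A = A_{a₁}`».**  If `A` is not quasi-periodic and every `a ∈ A` off the coset `α + H` has
`H + a ⊆ A`, then `A ⊆ α + H`: the elements off the coset form an `H`-periodic part, which must be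
empty. [cite: Grynkiewicz2009, §6 Claim 5 («since A is non-quasi-periodic, A = A_{a₁}»)] -/
theorem sub_mem_of_forall_add_mem {A : Finset G} {H : AddSubgroup G} (hH : H ≠ ⊥)
    (hAqp : ¬ IsQuasiPeriodic A) (α : G)
    (h : ∀ a ∈ A, a - α ∉ H → ∀ g ∈ H, g + a ∈ A) : ∀ a ∈ A, a - α ∈ H := by
  classical
  set A₁ := A.filter fun x => x - α ∉ H with hA₁
  set A₀ := A.filter fun x => x - α ∈ H with hA₀
  have hdec : IsQuasiPeriodicDecomp H A A₁ A₀ := by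
    refine ⟨hH, ?_, ?_, ?_, ?_⟩
    · rw [hA₁, hA₀]
      exact disjoint_filter.2 fun x _ h1 h2 => h1 h2
    · rw [hA₁, hA₀, union_comm]; exact filter_union_filter_not_eq _ A
    · intro g hg
      refine eq_of_subset_of_card_le (fun z hz => ?_) (by rw [card_vadd_finset])
      obtain ⟨x, hx, rfl⟩ := mem_vadd_finset.1 hz
      rw [hA₁, mem_filter] at hx ⊢
      rw [vadd_eq_add]
      refine ⟨h x hx.1 hx.2 g hg, fun hmem => hx.2 ?_⟩
      have := H.sub_mem hmem hg
      rwa [show g + x - α - g = x - α by abel] at this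
    · intro x hx y hy
      rw [hA₀, mem_filter] at hx hy
      have := H.sub_mem hx.2 hy.2
      rwa [show x - α - (y - α) = x - y by abel] at this
  obtain ⟨hA₁e, -⟩ := hdec.left_eq_empty_of_not_isQuasiPeriodic hAqp
  intro a ha
  by_contra hnot
  have : a ∈ A₁ := by rw [hA₁, mem_filter]; exact ⟨ha, hnot⟩
  rw [hA₁e] at this
  exact notMem_empty a this

/-- **«`|{φ_H(aᵢ)}| = 1` ⟹ `H = G`».**  In the setting of Claim 5 (`(A + B) ∪ {γ₁, γ₂} = A + B + H`),
if every relevant `a ∈ A` (one with `a + b ≡ γ₁` or `γ₂ (mod H)` for some `b ∈ B`) lies in the coset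
`a₁ + H`, then — `A` being non-extendible, not quasi-periodic, with `0 ∈ A` and `⟨A⟩ = G` — `H = G`:
for `a` off that coset and `g ∈ H`, `(g + a) + B ⊆ A + B + H` avoids `γ₁, γ₂`, so `g + a ∈ A` by
non-extendibility; hence `A ⊆ a₁ + H` (`sub_mem_of_forall_add_mem`) and `⟨A⟩ = G` gives `H = G`.
[cite: Grynkiewicz2009, §6 Claim 5 (p. 25)] -/
theorem eq_top_of_relevant_subset_coset {A B Hf : Finset G} {H : AddSubgroup G} {γ₁ γ₂ a₁ : G}
    (hHf : ∀ g, g ∈ Hf ↔ g ∈ H) (hH : H ≠ ⊥)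
    (hC' : insert γ₁ (insert γ₂ (A + B)) = A + B + Hf)
    (hneA : IsNonExtendible A B) (hAqp : ¬ IsQuasiPeriodic A) (h0A : (0 : G) ∈ A)
    (hgen : AddSubgroup.closure (A : Set G) = ⊤)
    (hrel : ∀ a ∈ A, ∀ b ∈ B, (a + b - γ₁ ∈ H ∨ a + b - γ₂ ∈ H) → a - a₁ ∈ H) : H = ⊤ := by
  refine eq_top_of_coset_of_closure_eq_top h0A hgen
    (sub_mem_of_forall_add_mem hH hAqp a₁ fun a ha haα g hg => ?_)
  by_contra hga
  apply hneA (g + a) hga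
  refine Subset.antisymm (fun z hz => ?_) (add_subset_add_right (subset_insert _ _))
  obtain ⟨x, hx, b, hb, rfl⟩ := mem_add.1 hz
  rw [mem_insert] at hx
  rcases hx with rfl | hx
  · have hmem : g + a + b ∈ insert γ₁ (insert γ₂ (A + B)) := by
      rw [hC', show g + a + b = a + b + g by abel]
      exact add_mem_add (add_mem_add ha hb) ((hHf g).2 hg)
    rw [mem_insert, mem_insert] at hmem
    rcases hmem with h1 | h1 | h1
    · exfalso
      refine haα (hrel a ha b hb (Or.inl ?_))
      have := H.neg_mem hg
      rwa [show -g = a + b - γ₁ by rw [← h1]; abel] at this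
    · exfalso
      refine haα (hrel a ha b hb (Or.inr ?_))
      have := H.neg_mem hg
      rwa [show -g = a + b - γ₂ by rw [← h1]; abel] at this
    · exact h1
  · exact add_mem_add hx hb

/-- **The counting at the end of the paragraph.**  For finite `G`: if `(A, B)` is non-extendible (in
`A`), `|A + B| = |A| + |B| = |G| − 2` and `γ ∉ A + B`, then (17) holds: there are `|G| − |B| > |A|`
elements `α` with `γ ∉ α + B`, so one lies outside `A`; then `|G| − |A| − 1 > |B|` elements `β` with
`γ ∉ β + (A ∪ {α})`, so one lies outside `B`; `(A ∪ {α}) + (B ∪ {β}) ⊆ G ∖ γ` and non-extendibility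
give `|(A ∪ {α}) + (B ∪ {β})| = |G| − 1 = |A ∪ {α}| + |B ∪ {β}| − 1`.
[cite: Grynkiewicz2009, §6 Claim 5 (p. 25)] -/
theorem seventeen_of_card_univ_eq [Fintype G] {A B : Finset G} {γ : G} (hneA : IsNonExtendible A B)
    (hAB : #(A + B) = #A + #B) (hG : Fintype.card G = #(A + B) + 2) (hγ : γ ∉ A + B) :
    ∃ α β : G, #(insert α A + insert β B) + 1 = #(insert α A) + #(insert β B) := by
  classical
  have hinj : Function.Injective fun x : G => γ - x := fun x y h => by simpa using h
  -- an `α ∉ A` with `γ ∉ α + B`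
  have hT : #A < #(univ \ B.image fun b => γ - b) := by
    rw [card_sdiff_of_subset (subset_univ _), card_univ, card_image_of_injective _ hinj]; omega
  obtain ⟨α, hαT, hαA⟩ := exists_mem_notMem_of_card_lt_card hT
  have hαB : ∀ b ∈ B, α + b ≠ γ := fun b hb h => by
    rw [mem_sdiff] at hαT
    exact hαT.2 (mem_image.2 ⟨b, hb, by rw [← h]; abel⟩)
  -- a `β ∉ B` with `γ ∉ β + (A ∪ {α})`
  have hU : #B < #(univ \ (insert α A).image fun a => γ - a) := by
    rw [card_sdiff_of_subset (subset_univ _), card_univ, card_image_of_injective _ hinj,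
      card_insert_of_notMem hαA]; omega
  obtain ⟨β, hβU, hβB⟩ := exists_mem_notMem_of_card_lt_card hU
  have hβA : ∀ a ∈ insert α A, a + β ≠ γ := fun a ha h => by
    rw [mem_sdiff] at hβU
    exact hβU.2 (mem_image.2 ⟨a, ha, by rw [← h]; abel⟩)
  refine ⟨α, β, ?_⟩
  have hup : #(insert α A + insert β B) ≤ #(A + B) + 1 := by
    have hsub : insert α A + insert β B ⊆ univ.erase γ := by
      intro z hz
      rw [mem_erase]
      refine ⟨?_, mem_univ _⟩
      obtain ⟨a, ha, b, hb, rfl⟩ := mem_add.1 hz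
      rw [mem_insert] at hb
      rcases hb with rfl | hb
      · exact hβA a ha
      · rw [mem_insert] at ha
        rcases ha with rfl | ha
        · exact hαB b hb
        · exact fun h => hγ (h ▸ add_mem_add ha hb)
    have := card_le_card hsub
    rw [card_erase_of_mem (mem_univ _), card_univ] at this
    omega
  have hlow : #(A + B) + 1 ≤ #(insert α A + insert β B) := by
    have hss : A + B ⊂ insert α A + B :=
      Finset.ssubset_iff_subset_ne.2 ⟨add_subset_add_right (subset_insert _ _), (hneA α hαA).symm⟩
    exact (card_lt_card hss).trans_le (card_le_card (add_subset_add_left (subset_insert _ _)))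
  rw [card_insert_of_notMem hαA, card_insert_of_notMem hβB]
  omega

/-- **Claim 5, second paragraph: «`|{φ_H(aᵢ)}| = 1` ⟹ (17)».**  For finite `G`, in the setting of
Claim 5 (`γ₁ ≠ γ₂ ∉ A + B`, `(A + B) ∪ {γ₁, γ₂} = A + B + H`, `H ≠ 0`), with `A` non-extendible, not
quasi-periodic, `0 ∈ A`, `⟨A⟩ = G` and `|A + B| = |A| + |B|`: if all relevant `a ∈ A` lie in one
`H`-coset, then (17) holds (`H = G` by `eq_top_of_relevant_subset_coset`, so `|G| = |A + B| + 2`, and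
`seventeen_of_card_univ_eq`). [cite: Grynkiewicz2009, §6 Claim 5 (p. 25)] -/
theorem seventeen_of_relevant_subset_coset [Fintype G] {A B Hf : Finset G} {H : AddSubgroup G}
    {γ₁ γ₂ a₁ : G} (hHf : ∀ g, g ∈ Hf ↔ g ∈ H) (hH : H ≠ ⊥)
    (hC' : insert γ₁ (insert γ₂ (A + B)) = A + B + Hf)
    (hneA : IsNonExtendible A B) (hAqp : ¬ IsQuasiPeriodic A) (h0A : (0 : G) ∈ A)
    (hgen : AddSubgroup.closure (A : Set G) = ⊤) (hAB : #(A + B) = #A + #B)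
    (hγ₁ : γ₁ ∉ A + B) (hγ₂ : γ₂ ∉ A + B) (hne : γ₁ ≠ γ₂)
    (hrel : ∀ a ∈ A, ∀ b ∈ B, (a + b - γ₁ ∈ H ∨ a + b - γ₂ ∈ H) → a - a₁ ∈ H) :
    ∃ α β : G, #(insert α A + insert β B) + 1 = #(insert α A) + #(insert β B) := by
  classical
  have htop := eq_top_of_relevant_subset_coset hHf hH hC' hneA hAqp h0A hgen hrel
  have hHfu : Hf = univ := eq_univ_of_forall fun g => (hHf g).2 (by rw [htop]; trivial)
  have hCne : (A + B).Nonempty := by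
    by_contra hE
    rw [not_nonempty_iff_eq_empty] at hE
    have : γ₁ ∈ insert γ₁ (insert γ₂ (A + B)) := mem_insert_self _ _
    rw [hC', hE, empty_add] at this
    exact notMem_empty _ this
  have huniv : insert γ₁ (insert γ₂ (A + B)) = univ := by
    rw [hC', hHfu]
    refine eq_univ_of_forall fun g => ?_
    obtain ⟨c, hc⟩ := hCne
    exact mem_add.2 ⟨c, hc, g - c, mem_univ _, by abel⟩
  have hG : Fintype.card G = #(A + B) + 2 := by
    have hγ₁' : γ₁ ∉ insert γ₂ (A + B) := by rw [mem_insert, not_or]; exact ⟨hne, hγ₁⟩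
    rw [← card_univ, ← huniv, card_insert_of_notMem hγ₁', card_insert_of_notMem hγ₂]
  exact seventeen_of_card_univ_eq hneA hAB hG hγ₁

/-- **«By the same argument, `|{φ_H(bᵢ)}| ≥ 2`»**: the mirror statement — if all relevant `b ∈ B`
lie in one `H`-coset, then (17) holds. [cite: Grynkiewicz2009, §6 Claim 5 (p. 25)] -/
theorem seventeen_of_relevant_subset_coset_right [Fintype G] {A B Hf : Finset G}
    {H : AddSubgroup G} {γ₁ γ₂ b₁ : G} (hHf : ∀ g, g ∈ Hf ↔ g ∈ H) (hH : H ≠ ⊥)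
    (hC' : insert γ₁ (insert γ₂ (A + B)) = A + B + Hf)
    (hneB : IsNonExtendible B A) (hBqp : ¬ IsQuasiPeriodic B) (h0B : (0 : G) ∈ B)
    (hgenB : AddSubgroup.closure (B : Set G) = ⊤) (hAB : #(A + B) = #A + #B)
    (hγ₁ : γ₁ ∉ A + B) (hγ₂ : γ₂ ∉ A + B) (hne : γ₁ ≠ γ₂)
    (hrel : ∀ a ∈ A, ∀ b ∈ B, (a + b - γ₁ ∈ H ∨ a + b - γ₂ ∈ H) → b - b₁ ∈ H) :
    ∃ α β : G, #(insert α A + insert β B) + 1 = #(insert α A) + #(insert β B) := by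
  have hBA : #(B + A) = #B + #A := by rw [add_comm, hAB, add_comm]
  have hC'' : insert γ₁ (insert γ₂ (B + A)) = B + A + Hf := by rw [add_comm B A, hC']
  have hγ₁' : γ₁ ∉ B + A := by rwa [add_comm]
  have hγ₂' : γ₂ ∉ B + A := by rwa [add_comm]
  have hrel' : ∀ b ∈ B, ∀ a ∈ A, (b + a - γ₁ ∈ H ∨ b + a - γ₂ ∈ H) → b - b₁ ∈ H :=
    fun b hb a ha h => hrel a ha b hb (by rwa [add_comm a b])
  exact seventeen_symm (seventeen_of_relevant_subset_coset hHf hH hC'' hneB hBqp h0B hgenB hBA hγ₁'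
    hγ₂' hne hrel')

end Grynkiewicz2009

end Literature.Combinatorics.Additive
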